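import Literature.AnabelianGeometry.SemiGraphs.TieBijective
import Literature.AnabelianGeometry.SemiGraphs.TieClosedFamilies
import Literature.AnabelianGeometry.SemiGraphs.GraphCoveringSurjective

/-!
# The TIE without connectedness hypotheses ([SemiAnbd] Def. 2.2 (i) p. 23, Rem. 2.4.2 p. 26)

Mochizuki, *Semi-graphs of anabelioids*, Publ. RIMS **42** (2006) 221–322, §2: Def. 2.2 (i) p. 23 (the
finite étale covering `ℋ → 𝒦` attached to `A ∈ B(𝒦)`: "the vertices (respectively, edges) of `𝔾′` that
lie over a vertex `v` (respectively, an edge `e`) correspond to the connected components of `S_v`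
(respectively, `T_e`)"), Rem. 2.4.2 p. 26 [cite: MochizukiSemiAnbd2006, Def. 2.2(i) p.23].

PROOF-ONLY (abc-iut cell, layer L3; FACT-LIST row F-1478 `remark_2_4_1_covering`; GAP-LEDGER row
G-w5d041-g4-1 «tie WITHOUT connectedness», DISCHARGED here; seat abc-iut-f-161).  abc-iut-f-161's
`Hom.tie_bijective` (the canonical labels `O(w) ⊆ A_u`, `O(e′) ⊆ A_e` of a four-clause finite étale
covering `ψ : ℋ → 𝒦` of `A` — the components holding the global base points — are BIJECTIONS onto
`Σ_u π₀(A_u)`, `Σ_e π₀(A_e)`) assumed `ℋ` and `𝒦` CONNECTED, through the degree count on a connected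
`𝔾_A`.  `tie_bijective_general` proves the same five clauses for ARBITRARY `ℋ`, `𝒦`: the labelled lift
`ℋ.graph → 𝔾_A` is a graph-covering over `𝕂` with the base's fibre cardinalities whose image meets
every nonempty family of components closed under "the component under" — because such a family is the
component family of a sub-object `Z ↪ A` and `αψ(Z → A) ∈ B(ℋ)` is non-initial
(`TieClosedFamilies`) — hence surjective, hence bijective (`GraphCoveringSurjective`).

Consumer: `remark_2_4_1_covering_holds` (F-1478 as typed) through abc-iut-w5-d041's
`remark_2_4_1_covering_of_tie`.  No `def`, no new `Prop`; nothing here takes a side on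
[IUTchIII] Cor. 3.12.
-/

namespace Literature.AnabelianGeometry.SemiGraphs

namespace SemiGraphOfAnabelioids

namespace Hom

open CategoryTheory CategoryTheory.Limits CategoryTheory.PreGaloisCategory
open Literature.AnabelianGeometry.Anabelioids

universe v₁ u₁ u

variable {ℋ 𝒦 : SemiGraphOfAnabelioids.{v₁, u₁, u}} (ψ : Hom ℋ 𝒦) (A : 𝒦.BObj)
  [HasBinaryProducts 𝒦.BObj] (αψ : Over A ⥤ ℋ.BObj) [αψ.IsEquivalence]
  (eψ : ψ.pullbackFunctor ≅ Over.star A ⋙ αψ)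

set_option backward.isDefEq.respectTransparency false in
/-- **THE TIE, without connectedness hypotheses** ([SemiAnbd] Def. 2.2 (i): the vertices and edges of
the covering ARE the connected components of the `A_u`, `A_e`).  Let `ψ : ℋ → 𝒦` be a morphism of
semi-graphs of anabelioids (no connectedness assumed on `ℋ` or `𝒦`) which is LOCALLY the covering
attached to `A ∈ B(𝒦)` (`IsFiniteEtaleCoveringOf`), GLOBALLY so through the witness
`αψ : B(𝒦)_{/A} ⥲ B(ℋ)`, `e_ψ : ψ^* ≅ (A × −) ⋙ αψ`, BRANCH-ALIGNED and VERTEX-ALIGNED.  Then there are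
labels `O(w) ∈ π₀(A_{ψ w})`, `O(e′) ∈ π₀(A_{ψ e′})` such that (1) `w ↦ (ψ w, O w)` is a bijection onto
`Σ_u π₀(A_u)`; (2) `e′ ↦ (ψ e′, O e′)` is a bijection onto `Σ_e π₀(A_e)`; (3)/(4) `O(w)` (resp. `O(e′)`)
is THE component through which the constituent at `w` (resp. `e′`) of the tautological section
`g = αψ(η_{𝟙_A}) ≫ e_ψ⁻¹_A` factors; (5) abutment compatibility `componentOver (O e(b′)) = O w`.
Assembly as in `tie_bijective`, with the degree count on a connected `𝔾_A` replaced by: every nonempty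
family of components closed under "the component under" contains a label
(`exists_label_mem_of_closedFamily`), so the labelled lift is a SURJECTIVE graph-covering with the
base's fibre cardinalities (`labels_bijective_of_hits`). [cite: MochizukiSemiAnbd2006, Def. 2.2(i) p.23] -/
theorem tie_bijective_general (hloc : ψ.IsFiniteEtaleCoveringOf A) (hal : ψ.IsBranchAligned)
    (hva : ψ.IsVertexAligned) :
    ∃ (O : ∀ w : ℋ.graph.Vertex, π₀Obj (A.S (ψ.base.vertexMap w)))
      (OE : ∀ e' : ℋ.graph.Edge, π₀Obj (A.T (ψ.base.edgeMap e'))),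
      Function.Bijective (fun w : ℋ.graph.Vertex =>
        (⟨ψ.base.vertexMap w, O w⟩ : Σ u, π₀Obj (A.S u))) ∧
      Function.Bijective (fun e' : ℋ.graph.Edge =>
        (⟨ψ.base.edgeMap e', OE e'⟩ : Σ e, π₀Obj (A.T e))) ∧
      (∀ (w : ℋ.graph.Vertex) (P : π₀Obj (A.S (ψ.base.vertexMap w))),
        P = O w ↔ ∃ k : (αψ.obj (Over.mk (𝟙 A))).S w ⟶
            (ψ.φV w).pullback.obj (P.1 : 𝒦.V (ψ.base.vertexMap w)),
          k ≫ (ψ.φV w).pullback.map P.1.arrow =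
            (αψ.map ((Over.forgetAdjStar A).unit.app (Over.mk (𝟙 A))) ≫ eψ.inv.app A).fS w) ∧
      (∀ (e' : ℋ.graph.Edge) (Q : π₀Obj (A.T (ψ.base.edgeMap e'))),
        Q = OE e' ↔ ∃ k : (αψ.obj (Over.mk (𝟙 A))).T e' ⟶
            (ψ.φE e' (ψ.base.edgeMap e') rfl).pullback.obj (Q.1 : 𝒦.E (ψ.base.edgeMap e')),
          k ≫ (ψ.φE e' (ψ.base.edgeMap e') rfl).pullback.map Q.1.arrow =
            (αψ.map ((Over.forgetAdjStar A).unit.app (Over.mk (𝟙 A))) ≫ eψ.inv.app A).fT e') ∧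
      (∀ (b' : ℋ.graph.Branch) (w : ℋ.graph.Vertex) (h' : ℋ.graph.abuts b' = some w),
        A.componentOver (ψ.base.branchMap b') (ψ.base.vertexMap w) (ψ.base.abuts_branchMap b' w h')
            ((ψ.base.edgeOf_branchMap b').symm ▸ OE (ℋ.graph.edgeOf b')) = O w) := by
  classical
  -- the labels
  have hU := fun w => existsUnique_component_section_factors ψ A αψ eψ w
  have hUE := fun e' => existsUnique_component_sectionE_factors ψ A αψ eψ e'
  choose O hO using fun w => (hU w).exists
  choose OE hOE using fun e' => (hUE e').exists
  -- (5) abutment compatibility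
  have h5 : ∀ (b' : ℋ.graph.Branch) (w : ℋ.graph.Vertex) (h' : ℋ.graph.abuts b' = some w),
      A.componentOver (ψ.base.branchMap b') (ψ.base.vertexMap w) (ψ.base.abuts_branchMap b' w h')
        ((ψ.base.edgeOf_branchMap b').symm ▸ OE (ℋ.graph.edgeOf b')) = O w := fun b' w h' =>
    componentOver_eq_of_section_factors ψ A αψ eψ w b' h' (ψ.base.branchMap b') rfl (O w) (hO w) _
      (sectionE_factors_reindex ψ A αψ eψ _ _ (ψ.edgeMap_edgeOf_of_branchMap b' _ rfl) (OE _) (hOE _))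
  -- the local description
  obtain ⟨hprop, cV, cE, hbijV, hbijE, hαV, -, hbr⟩ := _root_.id hloc
  -- the fibre data `𝔾_A` and the shrunk labels
  let D := A.fibreData
  let ℓV : ∀ w : ℋ.graph.Vertex, D.FV (ψ.base.vertexMap w) := fun w => equivShrink _ (O w)
  let ℓE : ∀ e' : ℋ.graph.Edge, D.FE (ψ.base.edgeMap e') := fun e' => equivShrink _ (OE e')
  haveI : ∀ u, Finite (D.FV u) := fun u => Finite.of_equiv _ (equivShrink (π₀Obj (A.S u)))
  haveI : ∀ e, Finite (D.FE e) := fun e => Finite.of_equiv _ (equivShrink (π₀Obj (A.T e)))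
  have hcast : ∀ {e₁ e₂ : 𝒦.graph.Edge} (h : e₁ = e₂) (Q : π₀Obj (A.T e₁)),
      cast (congrArg D.FE h) (equivShrink _ Q) = equivShrink _ (h ▸ Q : π₀Obj (A.T e₂)) := by
    intro e₁ e₂ h Q
    subst h
    rfl
  -- compatibility with abutment
  have hcompat : ∀ (b' : ℋ.graph.Branch) (w : ℋ.graph.Vertex) (h' : ℋ.graph.abuts b' = some w),
      D.σ (ψ.base.branchMap b') (ψ.base.vertexMap w) (ψ.base.abuts_branchMap b' w h')
        (cast (congrArg D.FE (ψ.base.edgeOf_branchMap b').symm) (ℓE (ℋ.graph.edgeOf b'))) = ℓV w := by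
    intro b' w h'
    change equivShrink _ (A.componentOver _ _ _
      ((equivShrink _).symm (cast _ (equivShrink _ (OE (ℋ.graph.edgeOf b')))))) = equivShrink _ (O w)
    rw [hcast (ψ.base.edgeOf_branchMap b').symm, Equiv.symm_apply_apply, h5 b' w h']
  -- injectivity on stars
  have hinj : ∀ (w : ℋ.graph.Vertex) (b'₁ b'₂ : ℋ.graph.Branch), ℋ.graph.abuts b'₁ = some w →
      ℋ.graph.abuts b'₂ = some w → ψ.base.branchMap b'₁ = ψ.base.branchMap b'₂ →
      (⟨ψ.base.edgeMap (ℋ.graph.edgeOf b'₁), ℓE (ℋ.graph.edgeOf b'₁)⟩ : Σ e, D.FE e) =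
        ⟨ψ.base.edgeMap (ℋ.graph.edgeOf b'₂), ℓE (ℋ.graph.edgeOf b'₂)⟩ → b'₁ = b'₂ :=
    fun w b'₁ b'₂ h₁ h₂ hb hs =>
      branch_eq_of_sectionE_label_eq ψ A αψ eψ hloc hal hva w b'₁ b'₂ h₁ h₂ hb (OE _) (OE _) (hOE _)
        (hOE _) (sigma_eq_of_sigma_shrink_eq A _ _ hs)
  -- the star count: through `cV w ≅ O w` and the local clause
  have hcard : ∀ (w : ℋ.graph.Vertex) (b : 𝒦.graph.Branch)
      (hb : 𝒦.graph.abuts b = some (ψ.base.vertexMap w)),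
      Nat.card {c : D.FE (𝒦.graph.edgeOf b) // D.σ b (ψ.base.vertexMap w) hb c = ℓV w} ≤
        Nat.card {b' : ℋ.graph.Branch // ℋ.graph.abuts b' = some w ∧ ψ.base.branchMap b' = b} := by
    intro w b hb
    obtain ⟨αw, hαw, ⟨ew⟩⟩ := hαV w
    haveI := hαw
    haveI := (cV w).2
    obtain ⟨i, -⟩ := nonempty_iso_of_localGlobalSection ψ A αψ eψ hva w
      ((cV w).1 : 𝒦.V (ψ.base.vertexMap w)) (cV w).1.arrow αw ew (O w) (hO w)
    have e1 : {c : D.FE (𝒦.graph.edgeOf b) // D.σ b (ψ.base.vertexMap w) hb c = ℓV w} ≃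
        {Q : π₀Obj (A.T (𝒦.graph.edgeOf b)) // A.componentOver b (ψ.base.vertexMap w) hb Q = O w} :=
      Equiv.subtypeEquiv (equivShrink _).symm (fun c =>
        (equivShrink (π₀Obj (A.S (ψ.base.vertexMap w)))).apply_eq_iff_eq)
    calc Nat.card {c : D.FE (𝒦.graph.edgeOf b) // D.σ b (ψ.base.vertexMap w) hb c = ℓV w}
        = Nat.card {Q : π₀Obj (A.T (𝒦.graph.edgeOf b)) //
            A.componentOver b (ψ.base.vertexMap w) hb Q = O w} := Nat.card_congr e1
      _ = Nat.card {Q : π₀Obj (A.T (𝒦.graph.edgeOf b)) //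
            Q.1 ≤ A.branchImage b (ψ.base.vertexMap w) hb (O w).1} :=
          Nat.card_congr (Equiv.subtypeEquivRight fun Q =>
            A.componentOver_eq_iff_le_branchImage b _ hb Q (O w))
      _ = Nat.card {Q : π₀Obj (A.T (𝒦.graph.edgeOf b)) //
            Q.1 ≤ A.branchImage b (ψ.base.vertexMap w) hb (cV w).1} :=
          (A.natCard_le_branchImage_eq_of_iso b _ hb (cV w) (O w) i).symm
      _ = Nat.card {Q : π₀Obj (A.T (𝒦.graph.edgeOf b)) //
            A.componentOver b (ψ.base.vertexMap w) hb Q = cV w} :=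
          Nat.card_congr (Equiv.subtypeEquivRight fun Q =>
            (A.componentOver_eq_iff_le_branchImage b _ hb Q (cV w)).symm)
      _ ≤ _ := natCard_componentOver_eq_le_natCard_branches ψ A cV cE hprop hbijV.1 hbijE hbr w b hb
  -- every nonempty family of components closed under "the component under" contains a label
  have hhit : ∀ (SV : ∀ u, Set (D.FV u)) (SE : ∀ e, Set (D.FE e)),
      (∀ (b : 𝒦.graph.Branch) (u : 𝒦.graph.Vertex) (hb : 𝒦.graph.abuts b = some u)
        (c : D.FE (𝒦.graph.edgeOf b)), c ∈ SE (𝒦.graph.edgeOf b) ↔ D.σ b u hb c ∈ SV u) →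
      ((∃ u x, x ∈ SV u) ∨ (∃ e c, c ∈ SE e)) →
      (∃ w, ℓV w ∈ SV (ψ.base.vertexMap w)) ∨ (∃ e', ℓE e' ∈ SE (ψ.base.edgeMap e')) := by
    intro SV SE hclS hneS
    let KV : ∀ u, Set (π₀Obj (A.S u)) := fun u => {P | equivShrink _ P ∈ SV u}
    let KE : ∀ e, Set (π₀Obj (A.T e)) := fun e => {Q | equivShrink _ Q ∈ SE e}
    have hcl : ∀ (b : 𝒦.graph.Branch) (u : 𝒦.graph.Vertex) (h : 𝒦.graph.abuts b = some u)
        (Q : π₀Obj (A.T (𝒦.graph.edgeOf b))),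
        Q ∈ KE (𝒦.graph.edgeOf b) ↔ A.componentOver b u h Q ∈ KV u := by
      intro b u h Q
      change equivShrink _ Q ∈ SE _ ↔ equivShrink _ (A.componentOver b u h Q) ∈ SV u
      rw [hclS b u h (equivShrink _ Q)]
      change equivShrink _ (A.componentOver b u h ((equivShrink _).symm (equivShrink _ Q))) ∈ SV u ↔ _
      rw [Equiv.symm_apply_apply]
    have hne : (∃ u P, P ∈ KV u) ∨ (∃ e Q, Q ∈ KE e) := by
      rcases hneS with ⟨u, x, hx⟩ | ⟨e, c, hc⟩
      · refine Or.inl ⟨u, (equivShrink _).symm x, ?_⟩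
        change equivShrink _ ((equivShrink _).symm x) ∈ SV u
        rwa [Equiv.apply_symm_apply]
      · refine Or.inr ⟨e, (equivShrink _).symm c, ?_⟩
        change equivShrink _ ((equivShrink _).symm c) ∈ SE e
        rwa [Equiv.apply_symm_apply]
    rcases exists_label_mem_of_closedFamily ψ A αψ eψ KV KE hcl hne with
      ⟨w, P, hP, hfac⟩ | ⟨e', Q, hQ, hfac⟩
    · have hPO : P = O w := (hU w).unique hfac (hO w)
      subst hPO
      exact Or.inl ⟨w, hP⟩
    · have hQO : Q = OE e' := (hUE e').unique hfac (hOE e')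
      subst hQO
      exact Or.inr ⟨e', hQ⟩
  -- the fibres of `ψ` have the cardinalities of `𝔾_A` (local labels)
  have eV : ∀ u, Nonempty (ψ.base.VertexFiber u ≃ D.FV u) := fun u =>
    D.nonempty_vertexFiber_equiv_of_bijective ψ.base (fun w => equivShrink _ (cV w))
      ((Equiv.sigmaCongrRight fun v => equivShrink (π₀Obj (A.S v))).bijective.comp hbijV) u
  have eE : ∀ e, Nonempty (ψ.base.EdgeFiber e ≃ D.FE e) := fun e =>
    D.nonempty_edgeFiber_equiv_of_bijective ψ.base (fun e' => equivShrink _ (cE e'))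
      ((Equiv.sigmaCongrRight fun e => equivShrink (π₀Obj (A.T e))).bijective.comp hbijE) e
  -- the labelled lift is a surjective graph-covering with the base's fibre cardinalities
  obtain ⟨hbV, hbE⟩ := D.labels_bijective_of_hits ψ.base ℓV ℓE hprop hcompat hinj hcard hhit eV eE
  refine ⟨O, OE, ?_, ?_, fun w P => ⟨fun h => h ▸ hO w, fun hP => (hU w).unique hP (hO w)⟩,
    fun e' Q => ⟨fun h => h ▸ hOE e', fun hQ => (hUE e').unique hQ (hOE e')⟩, h5⟩
  · have hf : (fun w : ℋ.graph.Vertex => (⟨ψ.base.vertexMap w, O w⟩ : Σ u, π₀Obj (A.S u))) =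
        (Equiv.sigmaCongrRight fun u => (equivShrink (π₀Obj (A.S u))).symm) ∘
          (fun w : ℋ.graph.Vertex => (⟨ψ.base.vertexMap w, ℓV w⟩ : Σ u, D.FV u)) := by
      funext w
      change _ = (⟨ψ.base.vertexMap w, (equivShrink _).symm (equivShrink _ (O w))⟩ :
        Σ u, π₀Obj (A.S u))
      rw [Equiv.symm_apply_apply]
    rw [hf]
    exact (Equiv.bijective _).comp hbV
  · have hf : (fun e' : ℋ.graph.Edge => (⟨ψ.base.edgeMap e', OE e'⟩ : Σ e, π₀Obj (A.T e))) =
        (Equiv.sigmaCongrRight fun e => (equivShrink (π₀Obj (A.T e))).symm) ∘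
          (fun e' : ℋ.graph.Edge => (⟨ψ.base.edgeMap e', ℓE e'⟩ : Σ e, D.FE e)) := by
      funext e'
      change _ = (⟨ψ.base.edgeMap e', (equivShrink _).symm (equivShrink _ (OE e'))⟩ :
        Σ e, π₀Obj (A.T e))
      rw [Equiv.symm_apply_apply]
    rw [hf]
    exact (Equiv.bijective _).comp hbE

end Hom

end SemiGraphOfAnabelioids

end Literature.AnabelianGeometry.SemiGraphs
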